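import Literature.MathematicalPhysics.QuantumFieldTheory.Balaban1983to89.B9Eq340TwoRouteHolonomy
import Literature.MathematicalPhysics.QuantumFieldTheory.Balaban1983to89.B9Eq340CovariantLipschitzY
import Literature.MathematicalPhysics.QuantumFieldTheory.Balaban1983to89.B9Eq335CoveragePAtLettersY
import Literature.MathematicalPhysics.QuantumFieldTheory.Balaban1983to89.B9MultiscaleSmoothPartitionY

/-!
# `Balaban1983to89.B9Eq340TransporterChangeY` — T. Bałaban, *Propagators for lattice gauge theories in a background field*, Commun. Math. Phys. **99** (1985) 389–434
# [Balaban1985BackgroundPropagators], (3.40) p. 397, (3.35) p. 396, (3.69) p. 404: NODE 00's two site transporter conventions — the record's symmetrised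
# `parSymY` (Hölder quotients of G′, the site pin of rows 18) and the taxicab `parSY` (= `taxiS`, the site class `bH13 = bHZPG (taxiS U)` of rows 20–21) — AGREE UP TO
# `(d+1)²·K(Mα₀)·L⁶·(|z − w|_T ∕ L^{j(z)})²` on every near pair under print's class (3.35)

statement-level skeleton of published theorems with citation tags; proofs where landed; nothing here is a claim about the Yang–Mills mass gap

THE PRINT.  (3.40) p. 397: «R(U(Γ_{x,x′})) … Γ_{x,x′} a shortest contour connecting points x and x′» — a contour is fixed by neither the site-sector nor the bond-sector display;
(3.69) p. 404 with (3.35) p. 396: every plaquette variable of a bond of `Ω_j` is within `O(1)Mα₀(Lʲη)⁻²·η²` of `1`.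

WHY THIS FILE (cell `pub-ymgap`, Track A node N06 [B9]; seat `pub-ymgap-dag-n06-c` g19, road R3 of the G′ Hölder layer `hp45W hpDGW h44G h43Gp` of rows 20–21, dag-n06-d
`DISPLAY-LEDGER-UF.md` §2).  The engine of rows 18 produces the (3.43) probe members of `G′(U)` at the site pin `𝔭 x = holderProbesSN∕SA … (𝔏 x).parS (bI x)` whose transporter is
the record's `parS = parSymY` (`B9CoReadingCoordsHolderSNear`), while the rows-20–21 consumers read the taxicab tables `taxiS U z z′ = parSY i U z z′` (site class `bH13`) and
`taxiB = parBY` (bond probes `holderProbesKA`, bond class `bXH`).  On a lex-increasing pair the two site conventions coincide; on a lex-decreasing pair `parSymY z w = (parSY w z)⁻¹`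
and `parSY z w` transport along the two different taxicab staircases, whose loop is `B9Eq340TwoRouteHolonomy.norm_parTaxiV_mul_parTaxiV_sub_one_le_supDist`.  THIS FILE reads
that holonomy at the record:
* §1 `norm_inv_sub_le_of_unitaryLike` — `‖A⁻¹ − B‖ ≤ ‖A·B − 1‖` (the companion `‖R(g₁)X − R(g₂)X‖ ≤ 2‖g₁ − g₂‖·‖X‖` — the pair probe along `g₂` is the pair probe along `g₁`
  plus a point term — is ALREADY in the tree: `B9Eq380CubeLetters.norm_R_sub_R_le_of_unitaryLike`; the sequel cites it).
* §2 ★★ `norm_parSymY_sub_parSY_le` — for unitary-like `U`, NO TIE between `z` and `w` and a bound `δ` on the plaquette variables based in the coordinate box between them: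
  `‖parSymY U z w − parSY U z w‖ ≤ ((d+1)·|z − w|_∞)²·δ` (`= 0` on the lex-increasing branch).
* §3 `two_mul_pow_levY_lt_period`, ★ `noTie_of_nearS` — a NEAR pair (`|z − w|_T ≤ L^{j(z)}`, `B9CoReadingCoordsHolderSNear.NearS`) has no tie (`2Lʲ < period = L^k·L·M_h·P′`);
  `supDist_symm_le_torusSupNorm` (`|chart⁻¹ w − chart⁻¹ z|_∞ ≤ |z − w|_T`).
* §4 `plaqU_self_eq_one`, `plaqU_swap_eq_inv`, ★★ `norm_plaqU_sub_one_le_box_of_reg335P` — under print's (3.35) for `SU(N)`-type letters (`bg9KP`, `c ≤ 10`) EVERY plaquette variable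
  based in the box of a near pair `(z, w)` is within `K_pl·L⁶·(L^{j(z)})⁻²` of `1`, `K_pl = 2K(1+K)e^{4K}`, `K = 10·L·(M·α₀)` (`B9Eq335CoveragePAtLettersY.norm_holY_sub_one_le_levelled_of_reg335P`
  + the level window `levY_window` at the box sites, two levels = `L⁴`, + the lemma's own `(L^{lev−1})⁻²` = `L²`).
* §5 ★★★ `norm_parSymY_sub_parSY_le_of_reg335P` — THE RECORD FORM: for `U` in print's class and a near pair,
  `‖parSymY U z w − parSY U z w‖ ≤ (d+1)²·K_pl·L⁶·(|z − w|_T ∕ L^{j(z)})²` — the factor `(|z − w|_T∕Lʲ)²` is what lets a Hölder pair weight `(η|z − w|_T)^{−s}` be traded for the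
  block-scale weight `(Lʲη)^{−s}` of a sup member (`(|z−w|∕Lʲ)^{2−s} ≤ 1`), the sequel's probe-majorant transfer.

HONEST SCOPE.  Elementary bookkeeping over def-Y's transport letters, n06-i's lassos (via `B9Eq340TwoRouteHolonomy`) and lit-balaban's∕n06-j's plaquette reading of (3.35); nothing of
[B9] asserted beyond that reading; COUNT-NEUTRAL; N06 NOT discharged; one finite lattice at a time — nothing continuum, nothing about the mass gap.  Cell `pub-ymgap` (HUMAN RULING
D-0062), Track A node N06 [B9], seat `pub-ymgap-dag-n06-c` (g19), 2026-08-29; a NEW file; 0 `def`, no `sorry`, no `axiom`, no `instance`, no `notation`.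
-/

namespace Literature.MathematicalPhysics.QuantumFieldTheory.Balaban1983to89.B9Eq340TransporterChangeY

open T4RelativeLadder (UnitaryLike norm_inv_sub_one_le norm_unit_mul_le norm_mul_unit_le)
open B4TorusKernel.MultiPeriod (circAbs torusSupNorm torusSupNorm_nonneg)
open B9BackgroundsKLevelV1 (CfgV1 shiftsV1 levV1)
open B9BackgroundsKLevelV1P (bg9KP)
open B9Eq39Adjoint (R plaqU)
open B6GlobalChartV1 (boxEquiv PV)
open B6Geom246MultiLevelBox (blkOf scale_bounds)
open B6KLevelCensusIndexV1 (KIdx kGeo)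
open B6MultiLevelTorusOperator (one_le_of_mem)
open B6Prop22KLevelTorusCensus.KTIdx (circAbs_le_torusSupNorm)
open B6Prop22KLevelTorusCensusEta (nKT nKT_pos)
open B9Eq340StepLasso (taxiSteps)
open B9Eq340TaxiRungs (OnArc)
open B9Eq340TaxiTelescope (min_val_le_of_onArc)
open B9Eq340TwoRouteHolonomy (norm_parTaxiV_mul_parTaxiV_sub_one_le_supDist)
open B9Eq340CovariantLipschitzY (min_val_sub_le_mul_pdist)
open B9Eq358TaxiLettersY (val_boxEquiv_symm_int)
open B9Eq335CoveragePAtLettersY (norm_holY_sub_one_le_levelled_of_reg335P)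
open B9MultiscaleSmoothPartitionY (levY_window)
open B6MemberOfCubeV1 (torusSupNorm_sub_le)
open B6HolderPairPlacementV1 (torusSupNorm_toBox_sub_le_supDist)
open Node00 (SiteY CfgY toKT levY parTaxiV parSY parSymY parSymY_of_le parSymY_of_not_le holY PlaqY)
open Node00.OpsYHolderFar (pdist one_le_NB)
open LatticeFieldCalculus (supDist)

noncomputable section

/-! ## §1 The inverse against a second unit -/

section Adjoint

variable {𝔸 : Type} [NormedRing 𝔸] [NormOneClass 𝔸]

omit [NormOneClass 𝔸] in
/-- `‖A⁻¹ − B‖ ≤ ‖A·B − 1‖` for a unitary-like `A` (`A⁻¹ − B = −A⁻¹(AB − 1)`). [cite: Balaban1985BackgroundPropagators, (3.5) p.391 («U(−Γ) = U(Γ)⁻¹»), bookkeeping] -/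
theorem norm_inv_sub_le_of_unitaryLike {A : 𝔸ˣ} (hA : UnitaryLike A) (B : 𝔸ˣ) :
    ‖((A⁻¹ : 𝔸ˣ) : 𝔸) - (B : 𝔸)‖ ≤ ‖((A * B : 𝔸ˣ) : 𝔸) - 1‖ := by
  have h : ((A⁻¹ : 𝔸ˣ) : 𝔸) - (B : 𝔸) = -(((A⁻¹ : 𝔸ˣ) : 𝔸) * (((A * B : 𝔸ˣ) : 𝔸) - 1)) := by
    rw [Units.val_mul, mul_sub, ← mul_assoc, Units.inv_mul, one_mul, mul_one, neg_sub]
  rw [h, norm_neg]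
  exact norm_unit_mul_le hA.inv _

end Adjoint

/-! ## §2 The two site conventions on one pair -/

section Site

variable {d ℓ : ℕ} {hd : 1 ≤ d + 1} {hL : Odd (ℓ + 1) ∧ 1 < ℓ + 1} {b₀ b₁ : ℝ}
variable {𝔸 : Type} [NormedRing 𝔸] [NormedAlgebra ℂ 𝔸] [CompleteSpace 𝔸] [NormOneClass 𝔸] (i : KIdx d ℓ hd hL b₀ b₁)

/-- ★★ **`parSymY` VS `parSY` ON ONE PAIR**: for unitary-like bond variables, a pair `(z, w)` of sites with no tie in any coordinate and every plaquette variable based in the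
coordinate box between `chart⁻¹ w` and `chart⁻¹ z` within `δ ≥ 0` of `1`: `‖parSymY U z w − parSY U z w‖ ≤ ((d+1)·|chart⁻¹ w − chart⁻¹ z|_∞)²·δ`.  On the branch `z ≤ w` (lex) the
two agree; otherwise `parSymY U z w = U(Γ_{w,z})⁻¹` and `‖U(Γ_{w,z})⁻¹ − U(Γ_{z,w})‖ ≤ ‖U(Γ_{w,z})U(Γ_{z,w}) − 1‖` is the two-route holonomy.
[cite: Balaban1985BackgroundPropagators, (3.40) p.397 («a shortest contour»), (3.5) p.391, (3.35) p.396] -/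
theorem norm_parSymY_sub_parSY_le {U : CfgY 𝔸 i} (hU : ∀ μ x, UnitaryLike (U μ x)) {δ : ℝ} (hδ0 : 0 ≤ δ) (z w : SiteY i)
    (hnt : ∀ ν : Fin (d + 1), (((boxEquiv i.hN).symm z) ν - ((boxEquiv i.hN).symm w) ν).val ≠ (((boxEquiv i.hN).symm w) ν - ((boxEquiv i.hN).symm z) ν).val ∨
      ((boxEquiv i.hN).symm w) ν = ((boxEquiv i.hN).symm z) ν)
    (hδ : ∀ (μ ν : Fin (d + 1)) (v : Site (PV d ℓ i.m i.K hd hL) 0), (∀ κ, OnArc (((boxEquiv i.hN).symm w) κ) (((boxEquiv i.hN).symm z) κ) (v κ)) →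
      ‖(plaqU (shiftsV1 (PV d ℓ i.m i.K hd hL)) U μ ν v : 𝔸) - 1‖ ≤ δ) :
    ‖(parSymY i U z w : 𝔸) - (parSY i U z w : 𝔸)‖ ≤
      ((((d + 1 : ℕ) : ℝ)) * (supDist ((boxEquiv i.hN).symm w) ((boxEquiv i.hN).symm z) : ℝ)) ^ 2 * δ := by
  by_cases hle : toLex z.1 ≤ toLex w.1
  · rw [parSymY_of_le hle, sub_self, norm_zero]; positivity
  · rw [parSymY_of_not_le hle]
    have hkey := norm_parTaxiV_mul_parTaxiV_sub_one_le_supDist (P := PV d ℓ i.m i.K hd hL) hU hδ0 ((boxEquiv i.hN).symm w) ((boxEquiv i.hN).symm z) hnt hδ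
    refine (norm_inv_sub_le_of_unitaryLike ?_ _).trans hkey
    rw [parSY, B9Eq340StepLasso.parTaxiV_eq_stepRun]
    exact B9Eq340StepLasso.unitaryLike_stepRun hU _ _

/-! ## §3 Near pairs have no tie -/

/-- the period of NODE 00's torus exceeds `2Lʲ` STRICTLY for every block level `j` (`period = Lᵏ·L·M_h·P′`, `M_h ≥ 8`, `P′ ≥ 5`, `j ≤ k`).
[cite: Balaban1984PropagatorsII, (2.1) p.224, bookkeeping] -/
theorem two_mul_pow_levY_lt_period (z : SiteY i) : 2 * (ℓ + 1) ^ levY i z < (PV d ℓ i.m i.K hd hL).sitesPerDir 0 := by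
  have hj : levY i z ≤ i.k := (scale_bounds i.D.toDomains (blkOf i.D.toDomains z)).2
  rw [← i.hN 0]
  show 2 * (ℓ + 1) ^ levY i z < (ℓ + 1) ^ i.k * ((ℓ + 1) * (i.Mh * i.P' 0))
  have h8 : 8 ≤ i.Mh := i.hM8
  have h5 : 5 ≤ i.P' 0 := i.hP5 0
  have hpow : (ℓ + 1) ^ levY i z ≤ (ℓ + 1) ^ i.k := Nat.pow_le_pow_right (by omega) hj
  have hpos : 0 < (ℓ + 1) ^ i.k := pow_pos (by omega) _
  have h40 : 40 ≤ i.Mh * i.P' 0 := le_trans (by norm_num) (Nat.mul_le_mul h8 h5)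
  have h40' : 40 ≤ (ℓ + 1) * (i.Mh * i.P' 0) := le_trans h40 (Nat.le_mul_of_pos_left _ (by omega))
  calc 2 * (ℓ + 1) ^ levY i z ≤ 2 * (ℓ + 1) ^ i.k := Nat.mul_le_mul_left _ hpow
    _ < 40 * (ℓ + 1) ^ i.k := by nlinarith
    _ ≤ ((ℓ + 1) * (i.Mh * i.P' 0)) * (ℓ + 1) ^ i.k := Nat.mul_le_mul_right _ h40'
    _ = (ℓ + 1) ^ i.k * ((ℓ + 1) * (i.Mh * i.P' 0)) := by ring

/-- a TIE between the two arc counts of distinct classes makes the count half the period: `(b − a).val = (a − b).val`, `a ≠ b` ⇒ `2·(b − a).val = n`.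
[cite: Balaban1984PropagatorsII, (2.1) p.224 (the periodic lattice), bookkeeping] -/
theorem two_mul_val_eq_of_tie {n : ℕ} [NeZero n] {a b : ZMod n} (hab : ¬ a = b) (htie : (b - a).val = (a - b).val) : 2 * (a - b).val = n := by
  have h0 : b - a ≠ 0 := fun h => hab (sub_eq_zero.1 h).symm
  have hneg : a - b = -(b - a) := (neg_sub b a).symm
  rw [hneg, ZMod.neg_val, if_neg h0] at htie
  have hlt := ZMod.val_lt (b - a)
  rw [hneg, ZMod.neg_val, if_neg h0]
  omega

/-- the chart's sup-distance is at most print's torus distance: `|chart⁻¹ w − chart⁻¹ z|_∞ ≤ |z − w|_T`. [cite: Balaban1984PropagatorsII, (2.1) p.224 (T_η), dictionary] -/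
theorem supDist_symm_le_torusSupNorm (z w : SiteY i) :
    (supDist ((boxEquiv i.hN).symm w) ((boxEquiv i.hN).symm z) : ℝ) ≤ torusSupNorm (toKT i).NB (z.1 - w.1) := by
  classical
  have hN := nKT_pos (toKT i)
  have hmul : ((nKT (toKT i) : ℕ) : ℝ) * pdist i w z = torusSupNorm (toKT i).NB (z.1 - w.1) := by
    unfold pdist; field_simp
  rw [← hmul]
  -- the sup is attained at some coordinate
  obtain ⟨ν, -, hν⟩ := Finset.exists_mem_eq_sup (Finset.univ : Finset (Fin (d + 1))) Finset.univ_nonempty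
    (fun μ : Fin (d + 1) => min (((boxEquiv i.hN).symm w) μ - ((boxEquiv i.hN).symm z) μ).val (((boxEquiv i.hN).symm z) μ - ((boxEquiv i.hN).symm w) μ).val)
  unfold supDist
  rw [hν, min_comm]
  exact min_val_sub_le_mul_pdist i w z ν

/-- ★ **A NEAR PAIR HAS NO TIE**: if `|z − w|_T ≤ L^{j(z)}` then in every coordinate the two arcs between `chart⁻¹ z` and `chart⁻¹ w` have different lengths (or the coordinates
agree) — a tie would make the shorter count half the period, but it is `≤ |z − w|_T ≤ Lʲ < period∕2`. [cite: Balaban1985BackgroundPropagators, (3.40) p.397; Balaban1984PropagatorsII, (2.1) p.224] -/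
theorem noTie_of_nearS {z w : SiteY i} (h : torusSupNorm (toKT i).NB (z.1 - w.1) ≤ (((ℓ + 1 : ℕ) : ℝ)) ^ levY i z) :
    ∀ ν : Fin (d + 1), (((boxEquiv i.hN).symm z) ν - ((boxEquiv i.hN).symm w) ν).val ≠ (((boxEquiv i.hN).symm w) ν - ((boxEquiv i.hN).symm z) ν).val ∨
      ((boxEquiv i.hN).symm w) ν = ((boxEquiv i.hN).symm z) ν := by
  intro ν
  by_cases heq : ((boxEquiv i.hN).symm w) ν = ((boxEquiv i.hN).symm z) ν
  · exact Or.inr heq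
  · refine Or.inl fun htie => ?_
    -- the shorter count is at most `|z − w|_T ≤ Lʲ`
    have hsd := supDist_symm_le_torusSupNorm i z w
    have hco : min (((boxEquiv i.hN).symm w) ν - ((boxEquiv i.hN).symm z) ν).val (((boxEquiv i.hN).symm z) ν - ((boxEquiv i.hN).symm w) ν).val ≤
        supDist ((boxEquiv i.hN).symm w) ((boxEquiv i.hN).symm z) :=
      Finset.le_sup (f := fun μ : Fin (d + 1) => min (((boxEquiv i.hN).symm w) μ - ((boxEquiv i.hN).symm z) μ).val
        (((boxEquiv i.hN).symm z) μ - ((boxEquiv i.hN).symm w) μ).val) (Finset.mem_univ ν)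
    have hnat : min (((boxEquiv i.hN).symm w) ν - ((boxEquiv i.hN).symm z) ν).val (((boxEquiv i.hN).symm z) ν - ((boxEquiv i.hN).symm w) ν).val ≤
        (ℓ + 1) ^ levY i z := by
      have hr : ((min (((boxEquiv i.hN).symm w) ν - ((boxEquiv i.hN).symm z) ν).val (((boxEquiv i.hN).symm z) ν - ((boxEquiv i.hN).symm w) ν).val : ℕ) : ℝ) ≤
          (((ℓ + 1 : ℕ) : ℝ)) ^ levY i z := le_trans (by exact_mod_cast hco) (hsd.trans h)
      exact_mod_cast hr
    rw [← htie, min_self] at hnat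
    -- a tie makes the count half the period
    haveI : NeZero ((PV d ℓ i.m i.K hd hL).sitesPerDir 0) := ⟨(Nat.lt_of_lt_of_le Nat.zero_lt_one ((PV d ℓ i.m i.K hd hL).one_lt_sitesPerDir 0).le).ne'⟩
    have h2 := two_mul_val_eq_of_tie heq htie
    have hper := two_mul_pow_levY_lt_period i z
    omega

/-! ## §4 Plaquettes in the box of a near pair, from print's (3.35) -/

omit [NormOneClass 𝔸] in
/-- a degenerate plaquette variable is `1`. [cite: Balaban1985BackgroundPropagators, (3.2) p.390, bookkeeping] -/
theorem plaqU_self_eq_one (U : CfgY 𝔸 i) (μ : Fin (d + 1)) (v : Site (PV d ℓ i.m i.K hd hL) 0) :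
    plaqU (shiftsV1 (PV d ℓ i.m i.K hd hL)) U μ μ v = 1 := by
  simp only [plaqU]; group

omit [NormOneClass 𝔸] in
/-- swapping the directions inverts the plaquette variable (`U(−∂p) = U(∂p)⁻¹`). [cite: Balaban1985BackgroundPropagators, (3.5) p.391, bookkeeping] -/
theorem plaqU_swap_eq_inv (U : CfgY 𝔸 i) (μ ν : Fin (d + 1)) (v : Site (PV d ℓ i.m i.K hd hL) 0) :
    plaqU (shiftsV1 (PV d ℓ i.m i.K hd hL)) U ν μ v = (plaqU (shiftsV1 (PV d ℓ i.m i.K hd hL)) U μ ν v)⁻¹ := by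
  simp only [plaqU, mul_inv_rev, inv_inv]; group

omit [NormOneClass 𝔸] in
/-- def-Y's `holY` at the plaquette `⟨v, μ, ν⟩` IS `plaqU … μ ν v`. [cite: Balaban1985BackgroundPropagators, (3.2) p.390, dictionary] -/
theorem holY_eq_plaqU (U : CfgY 𝔸 i) {μ ν : Fin (d + 1)} (hμν : μ < ν) (v : Site (PV d ℓ i.m i.K hd hL) 0) :
    holY i U ⟨v, μ, ν, hμν⟩ = plaqU (shiftsV1 (PV d ℓ i.m i.K hd hL)) U μ ν v := rfl

/-- a site of the box of a near pair is within `2·L^{j(z)}` of `z` in torus distance, hence of level `≥ j(z) − 1`.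
[cite: Balaban1984PropagatorsII, (2.2) p.224 (the two-level window), (2.54) p.233] -/
theorem levY_sub_one_le_levV1_of_box {z w : SiteY i} (h : torusSupNorm (toKT i).NB (z.1 - w.1) ≤ (((ℓ + 1 : ℕ) : ℝ)) ^ levY i z)
    {v : Site (PV d ℓ i.m i.K hd hL) 0} (hv : ∀ κ, OnArc (((boxEquiv i.hN).symm w) κ) (((boxEquiv i.hN).symm z) κ) (v κ)) :
    levY i z - 1 ≤ levV1 i v := by
  classical
  -- `|chart⁻¹ w − v|_∞ ≤ |chart⁻¹ w − chart⁻¹ z|_∞ ≤ |z − w|_T`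
  have hbox : supDist ((boxEquiv i.hN).symm w) v ≤ supDist ((boxEquiv i.hN).symm w) ((boxEquiv i.hN).symm z) :=
    Finset.sup_le fun μ _ => (min_val_le_of_onArc (hv μ)).trans
      (Finset.le_sup (f := fun μ : Fin (d + 1) => min (((boxEquiv i.hN).symm w) μ - ((boxEquiv i.hN).symm z) μ).val
        (((boxEquiv i.hN).symm z) μ - ((boxEquiv i.hN).symm w) μ).val) (Finset.mem_univ μ))
  have h1 : torusSupNorm (toKT i).NB (w.1 - (boxEquiv i.hN v).1) ≤ (supDist ((boxEquiv i.hN).symm w) v : ℝ) := by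
    have h : torusSupNorm (toKT i).NB ((boxEquiv i.hN ((boxEquiv i.hN).symm w)).1 - (boxEquiv i.hN v).1) ≤ (supDist ((boxEquiv i.hN).symm w) v : ℝ) :=
      torusSupNorm_toBox_sub_le_supDist i.hN ((boxEquiv i.hN).symm w) v
    rw [Equiv.apply_symm_apply] at h
    exact h
  have h2 : (supDist ((boxEquiv i.hN).symm w) ((boxEquiv i.hN).symm z) : ℝ) ≤ torusSupNorm (toKT i).NB (z.1 - w.1) := supDist_symm_le_torusSupNorm i z w
  have hwv : torusSupNorm (toKT i).NB (w.1 - (boxEquiv i.hN v).1) ≤ (((ℓ + 1 : ℕ) : ℝ)) ^ levY i z :=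
    h1.trans ((by exact_mod_cast hbox : (supDist ((boxEquiv i.hN).symm w) v : ℝ) ≤ _).trans (h2.trans h))
  -- triangle: `|v − z|_T ≤ |v − w|_T + |w − z|_T ≤ 2Lʲ ≤ 6Lʲ`
  have hN1 : ∀ μ, 1 ≤ (toKT i).NB μ := fun μ => one_le_of_mem z.2 μ
  have htri := torusSupNorm_sub_le hN1 (boxEquiv i.hN v).1 w.1 z.1
  have hvw : torusSupNorm (toKT i).NB ((boxEquiv i.hN v).1 - w.1) = torusSupNorm (toKT i).NB (w.1 - (boxEquiv i.hN v).1) := by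
    rw [← neg_sub, B6Geom246MultiLevelTorus.torusSupNorm_neg hN1]
  have hwz : torusSupNorm (toKT i).NB (w.1 - z.1) = torusSupNorm (toKT i).NB (z.1 - w.1) := by
    rw [← neg_sub, B6Geom246MultiLevelTorus.torusSupNorm_neg hN1]
  have hL1 : (1 : ℝ) ≤ ((ℓ + 1 : ℕ) : ℝ) := by exact_mod_cast Nat.succ_le_succ (Nat.zero_le ℓ)
  have hpow : (0 : ℝ) ≤ (((ℓ + 1 : ℕ) : ℝ)) ^ levY i z := by positivity
  have h6 : torusSupNorm (toKT i).NB ((boxEquiv i.hN v).1 - z.1) ≤ 6 * (((ℓ + 1 : ℕ) : ℝ)) ^ levY i z := by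
    rw [hvw, hwz] at htri; linarith
  have hwin := (levY_window i h6).1
  show levY i z - 1 ≤ levY i (boxEquiv i.hN v)
  omega

open scoped Matrix.Norms.L2Operator in
/-- ★★ **EVERY PLAQUETTE VARIABLE BASED IN THE BOX OF A NEAR PAIR IS WITHIN `K_pl·L⁶·(L^{j(z)})⁻²` OF `1` UNDER PRINT'S (3.35)** (`bg9KP`, `c ≤ 10`, `M·α₀ ≥ 0`, `N ≥ 1`;
`K_pl = 2K(1+K)e^{4K}`, `K = 10·L·(M·α₀)`): for `μ < ν` this is the levelled plaquette reading of (3.35) at a site of level `≥ j(z) − 1`; `μ = ν` is `1`; `μ > ν` is the inverse.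
[cite: Balaban1985BackgroundPropagators, (3.69) p.404, (3.35) p.396, (3.5) p.391] -/
theorem norm_plaqU_sub_one_le_box_of_reg335P {N : ℕ} [Nonempty (Fin N)] {G : Subgroup (Matrix (Fin N) (Fin N) ℂ)ˣ}
    (U : CfgY (Matrix (Fin N) (Fin N) ℂ) i) {c α₀ : ℝ} (hc : c ≤ 10) (hMα : 0 ≤ (kGeo i).M * α₀)
    (hreg : (bg9KP (Matrix (Fin N) (Fin N) ℂ) G i).Reg335 c α₀ U) (hG1 : ∀ u : (Matrix (Fin N) (Fin N) ℂ)ˣ, u ∈ G → ‖(u : Matrix (Fin N) (Fin N) ℂ)‖ ≤ 1)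
    {z w : SiteY i} (h : torusSupNorm (toKT i).NB (z.1 - w.1) ≤ (((ℓ + 1 : ℕ) : ℝ)) ^ levY i z)
    (μ ν : Fin (d + 1)) (v : Site (PV d ℓ i.m i.K hd hL) 0) (hv : ∀ κ, OnArc (((boxEquiv i.hN).symm w) κ) (((boxEquiv i.hN).symm z) κ) (v κ)) :
    ‖(plaqU (shiftsV1 (PV d ℓ i.m i.K hd hL)) U μ ν v : Matrix (Fin N) (Fin N) ℂ) - 1‖ ≤
      (2 * (10 * (kGeo i).L * ((kGeo i).M * α₀)) * (1 + 10 * (kGeo i).L * ((kGeo i).M * α₀)) * Real.exp (4 * (10 * (kGeo i).L * ((kGeo i).M * α₀))))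
        * ((kGeo i).L ^ 6 * ((((kGeo i).L ^ levY i z)⁻¹) ^ 2)) := by
  -- the constant and the scale
  set Kpl : ℝ := 2 * (10 * (kGeo i).L * ((kGeo i).M * α₀)) * (1 + 10 * (kGeo i).L * ((kGeo i).M * α₀)) *
    Real.exp (4 * (10 * (kGeo i).L * ((kGeo i).M * α₀))) with hKpl
  have hK0 : 0 ≤ 10 * (kGeo i).L * ((kGeo i).M * α₀) := by
    have := B9Eq335PlaquetteAtLettersY.one_le_L i; positivity
  have hKpl0 : 0 ≤ Kpl := by rw [hKpl]; positivity
  have hL1 : (1 : ℝ) ≤ (kGeo i).L := B9Eq335PlaquetteAtLettersY.one_le_L i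
  have hL0 : (0 : ℝ) < (kGeo i).L := lt_of_lt_of_le one_pos hL1
  -- unitary-likeness of the bond variables (for the inverse case)
  have hU : ∀ μ' x, UnitaryLike (U μ' x) := fun μ' x =>
    B9SectBGpLettersY.norm_le_one_and_inv_of_mem G hG1 (B9BackgroundsKLevelV1P.mem_of_reg335P i hreg μ' x)
  -- the scale comparison at a box site: `(L^{lev v − 1})⁻² ≤ L⁶·(L^{lev z})⁻²` from `lev v ≥ lev z − 1`
  have hlev := levY_sub_one_le_levV1_of_box i h hv
  have hscale : (((kGeo i).L ^ (levV1 i v - 1))⁻¹) ^ 2 ≤ (kGeo i).L ^ 6 * ((((kGeo i).L ^ levY i z)⁻¹) ^ 2) := by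
    have hle : levY i z ≤ (levV1 i v - 1) + 3 := by omega
    have hpow : (kGeo i).L ^ levY i z ≤ (kGeo i).L ^ ((levV1 i v - 1) + 3) := pow_le_pow_right₀ hL1 hle
    have hpos1 : 0 < (kGeo i).L ^ (levV1 i v - 1) := pow_pos hL0 _
    have hposz : 0 < (kGeo i).L ^ levY i z := pow_pos hL0 _
    rw [pow_add] at hpow
    -- `(L^{a})⁻¹ ≤ L³·(L^{lev z})⁻¹`
    have h1 : ((kGeo i).L ^ (levV1 i v - 1))⁻¹ ≤ (kGeo i).L ^ 3 * ((kGeo i).L ^ levY i z)⁻¹ := by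
      have hinv : ((kGeo i).L ^ (levV1 i v - 1) * (kGeo i).L ^ 3)⁻¹ ≤ ((kGeo i).L ^ levY i z)⁻¹ := inv_anti₀ hposz hpow
      have hL3 : 0 < (kGeo i).L ^ 3 := pow_pos hL0 3
      calc ((kGeo i).L ^ (levV1 i v - 1))⁻¹ = (kGeo i).L ^ 3 * ((kGeo i).L ^ (levV1 i v - 1) * (kGeo i).L ^ 3)⁻¹ := by
            field_simp
        _ ≤ (kGeo i).L ^ 3 * ((kGeo i).L ^ levY i z)⁻¹ := mul_le_mul_of_nonneg_left hinv hL3.le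
    have h0 : 0 ≤ ((kGeo i).L ^ (levV1 i v - 1))⁻¹ := inv_nonneg.2 hpos1.le
    calc (((kGeo i).L ^ (levV1 i v - 1))⁻¹) ^ 2 ≤ ((kGeo i).L ^ 3 * ((kGeo i).L ^ levY i z)⁻¹) ^ 2 := pow_le_pow_left₀ h0 h1 2
      _ = (kGeo i).L ^ 6 * ((((kGeo i).L ^ levY i z)⁻¹) ^ 2) := by ring
  have hRHS0 : 0 ≤ Kpl * ((kGeo i).L ^ 6 * ((((kGeo i).L ^ levY i z)⁻¹) ^ 2)) := by positivity
  -- the three cases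
  rcases lt_trichotomy μ ν with hμν | hμν | hμν
  · have key := norm_holY_sub_one_le_levelled_of_reg335P i U hc hMα hreg ⟨v, μ, ν, hμν⟩
    rw [holY_eq_plaqU i U hμν v] at key
    exact key.trans (mul_le_mul_of_nonneg_left hscale hKpl0)
  · subst hμν
    rw [plaqU_self_eq_one, Units.val_one, sub_self, norm_zero]
    exact hRHS0
  · have key := norm_holY_sub_one_le_levelled_of_reg335P i U hc hMα hreg ⟨v, ν, μ, hμν⟩
    rw [holY_eq_plaqU i U hμν v] at key
    rw [plaqU_swap_eq_inv i U ν μ v]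
    have hpu : UnitaryLike (plaqU (shiftsV1 (PV d ℓ i.m i.K hd hL)) U ν μ v) := by
      simp only [plaqU]; exact (((hU _ _).mul (hU _ _)).mul (hU _ _).inv).mul (hU _ _).inv
    exact (norm_inv_sub_one_le hpu).trans (key.trans (mul_le_mul_of_nonneg_left hscale hKpl0))

/-! ## §5 ★★★ The record form: `parSymY ≈ parSY` on near pairs under (3.35) -/

open scoped Matrix.Norms.L2Operator in
/-- ★★★ **NODE 00's TWO SITE TRANSPORTER CONVENTIONS AGREE ON NEAR PAIRS UNDER PRINT'S CLASS**: for `U` in print's (3.35) class of an `SU(N)`-type member (`bg9KP`, `c ≤ 10`,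
`G` with unit norms), and a near pair `|z − w|_T ≤ L^{j(z)}`:
`‖parSymY U z w − parSY U z w‖ ≤ (d+1)²·K_pl·L⁶·(|z − w|_T ∕ L^{j(z)})²`, `K_pl = 2K(1+K)e^{4K}`, `K = 10·L·(M·α₀)` — O(Mα₀) times the square of the pair distance in block units.
[cite: Balaban1985BackgroundPropagators, (3.40) p.397 («a shortest contour»), (3.69) p.404, (3.35) p.396, (3.5) p.391] -/
theorem norm_parSymY_sub_parSY_le_of_reg335P {N : ℕ} [Nonempty (Fin N)] {G : Subgroup (Matrix (Fin N) (Fin N) ℂ)ˣ}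
    (U : CfgY (Matrix (Fin N) (Fin N) ℂ) i) {c α₀ : ℝ} (hc : c ≤ 10) (hMα : 0 ≤ (kGeo i).M * α₀)
    (hreg : (bg9KP (Matrix (Fin N) (Fin N) ℂ) G i).Reg335 c α₀ U) (hG1 : ∀ u : (Matrix (Fin N) (Fin N) ℂ)ˣ, u ∈ G → ‖(u : Matrix (Fin N) (Fin N) ℂ)‖ ≤ 1)
    {z w : SiteY i} (h : torusSupNorm (toKT i).NB (z.1 - w.1) ≤ (((ℓ + 1 : ℕ) : ℝ)) ^ levY i z) :
    ‖(parSymY i U z w : Matrix (Fin N) (Fin N) ℂ) - (parSY i U z w : Matrix (Fin N) (Fin N) ℂ)‖ ≤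
      ((((d + 1 : ℕ) : ℝ)) ^ 2 *
        (2 * (10 * (kGeo i).L * ((kGeo i).M * α₀)) * (1 + 10 * (kGeo i).L * ((kGeo i).M * α₀)) * Real.exp (4 * (10 * (kGeo i).L * ((kGeo i).M * α₀)))) *
        (kGeo i).L ^ 6) * (torusSupNorm (toKT i).NB (z.1 - w.1) / (kGeo i).L ^ levY i z) ^ 2 := by
  have hU : ∀ μ' x, UnitaryLike (U μ' x) := fun μ' x =>
    B9SectBGpLettersY.norm_le_one_and_inv_of_mem G hG1 (B9BackgroundsKLevelV1P.mem_of_reg335P i hreg μ' x)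
  set Kpl : ℝ := 2 * (10 * (kGeo i).L * ((kGeo i).M * α₀)) * (1 + 10 * (kGeo i).L * ((kGeo i).M * α₀)) *
    Real.exp (4 * (10 * (kGeo i).L * ((kGeo i).M * α₀))) with hKpl
  have hL1 : (1 : ℝ) ≤ (kGeo i).L := B9Eq335PlaquetteAtLettersY.one_le_L i
  have hL0 : (0 : ℝ) < (kGeo i).L := lt_of_lt_of_le one_pos hL1
  have hK0 : 0 ≤ 10 * (kGeo i).L * ((kGeo i).M * α₀) := by positivity
  have hKpl0 : 0 ≤ Kpl := by rw [hKpl]; positivity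
  set δ : ℝ := Kpl * ((kGeo i).L ^ 6 * ((((kGeo i).L ^ levY i z)⁻¹) ^ 2)) with hδ
  have hδ0 : 0 ≤ δ := by positivity
  have key := norm_parSymY_sub_parSY_le i hU hδ0 z w (noTie_of_nearS i h)
    (fun μ ν v hv => norm_plaqU_sub_one_le_box_of_reg335P i U hc hMα hreg hG1 h μ ν v hv)
  refine key.trans ?_
  have hsd := supDist_symm_le_torusSupNorm i z w
  have hsd0 : (0 : ℝ) ≤ (supDist ((boxEquiv i.hN).symm w) ((boxEquiv i.hN).symm z) : ℝ) := Nat.cast_nonneg _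
  have hT0 : 0 ≤ torusSupNorm (toKT i).NB (z.1 - w.1) := torusSupNorm_nonneg (fun μ => one_le_of_mem z.2 μ) _
  have hLk : (kGeo i).L = ((ℓ + 1 : ℕ) : ℝ) := rfl
  have hposz : 0 < (kGeo i).L ^ levY i z := pow_pos hL0 _
  have hd0 : (0 : ℝ) ≤ ((d + 1 : ℕ) : ℝ) := Nat.cast_nonneg _
  calc ((((d + 1 : ℕ) : ℝ)) * (supDist ((boxEquiv i.hN).symm w) ((boxEquiv i.hN).symm z) : ℝ)) ^ 2 * δ
      ≤ ((((d + 1 : ℕ) : ℝ)) * torusSupNorm (toKT i).NB (z.1 - w.1)) ^ 2 * δ :=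
        mul_le_mul_of_nonneg_right (pow_le_pow_left₀ (mul_nonneg hd0 hsd0) (mul_le_mul_of_nonneg_left hsd hd0) 2) hδ0
    _ = ((((d + 1 : ℕ) : ℝ)) ^ 2 * Kpl * (kGeo i).L ^ 6) * (torusSupNorm (toKT i).NB (z.1 - w.1) / (kGeo i).L ^ levY i z) ^ 2 := by
        rw [hδ, div_eq_mul_inv]; ring

end Site

end

end Literature.MathematicalPhysics.QuantumFieldTheory.Balaban1983to89.B9Eq340TransporterChangeY
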